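import Summits.Ventures.GridStability.Models.SMIBEnergyRoa
import Literature.MathematicalPhysics.PowerSystems.SMIBEqualAreaCriterion

/-!
# GridStability/Models/SMIBEqualAreaK13 — the equal-area criterion as a KERNEL NUMBER for the instance of record «SMIB-K13post-D10»

Cell `gridfusion` (LADDER-GRIDFUSION G1.SMIB / sub-rung G1-cct, energy route), seat gridfusion-model-1,
`plan/PARTITION.md` §0 row `Models/`. THREE COLUMNS: an a-priori theorem about the typed MODEL
(MODELLED column: classical SMIB `M_smib`, MV-1; zero-power fault; `P_m′` per A1″ = MV-P; the
pre-fault angle as a DECLARED interval around the printed value) proved in the kernel from lit-1's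
equal-area theorems (`SMIBEqualAreaCriterion`, p475941) and lit-6's energy-well ROA (p465446) via the
dictionary `SMIB.toLit` (`SMIBEnergyRoa`). It is NOT an SOS certificate and says nothing about any
machine or grid; the simulated critical clearing times are VALIDATED comparators only.

## What is certified (lit-1 23:58:33Z programme «to make it a kernel number», executed)

Printed setting [cite: Kundur1994, Example 13.1]: post-fault plant `M = 2H/ω₀ = 7/377`,
`P_max = 1.1024 = 689/625` (circuit 2 out), `P_m = 0.9` (here `P_m′ = 79912287/88791425`, A1″),
damping variant `K_D = 10` ⇒ `D = 10/377` [cite: Kundur1994, Example 12.2 (iii)]; «`P_max = 0` during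
the fault»; «the initial values of δ and Δω_r are 41.77° and 0» [galaxy:panama:510353783914542 p0482,
via model-4 bench/data/SMIB/params.json quantities `P_max,fault`, `delta_0`]. `41.77° = 0.729024… rad`;
the theorem takes ANY pre-fault angle `δ(0) ∈ [0.7290, 0.7291]` (declared MODELLED interval containing
the printed value and the exact pre-fault equilibrium of the A1″ plant).

* `SMIB.K13fault Df` — the FAULT-ON record (zero-power fault, fault-on damping `Df ≥ 0` free);
* `SMIB.cos_09113_ge` — certified `0.6126 ≤ cos 0.9113` (angle-halving chain of `SMIBEnergyRoa`);
* `SMIB.K13postD10_equalArea_resync` — **for every fault-on motion of `K13fault Df` on `[0, T]`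
  from `(δ₀, 0)`, `δ₀ ∈ [0.7290, 0.7291]`, with clearing time `0 ≤ T ≤ 0.0866 s`, the clearing state
  admits a global post-fault solution of «SMIB-K13post-D10» and EVERY post-fault solution from it
  stays in the energy well (no pole slip) and tends to `(δˢ, 0)`.** Equal-area angle used:
  `δ₁ = 0.9113 rad (52.21°)`; certified ingredients `191/200 < δˢ` (`deltaK13_gt`), `cos δˢ = c*`,
  `π < 3.141593`.

So `t = 0.0866 s` is a KERNEL-PROVED (energy route, zero SDP; a-priori theorem, not an SOS certificate)
lower bound of the critical clearing time OF THE MODEL for this fault class. VALIDATED comparators (not claims): Kundur's equal-area value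
`δ_c = 52.29°`, simulated `t_cc = 0.0865 ± 0.0005 s` at `K_D = 0` [p0483]; the cell's RK4 CCT for
`K_D = 10` ∈ [0.117, 0.118] s (G1-LOG) and the SOS deg-4 driver value 0.114 s (sos-3) — the energy
route ignores fault-on and post-fault damping in the criterion, hence the gap. MODELLED: MV-1 + MV-P +
«zero-power fault» + «δ₀ ∈ [0.7290, 0.7291] declared».
-/

noncomputable section

open Real Set Filter Topology

namespace Summit.Ventures.GridStability.Models.SMIB

/-- FAULT-ON record of Kundur Ex. 13.1 for the A1″ plant: same machine (`M = 7/377`), mechanical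
input `P_m′`, electrical output ZERO during the three-phase fault («`P_max = 0` during the fault»
[cite: Kundur1994, Example 13.1]), fault-on damping coefficient `Df` (free; `10/377` for the `K_D = 10`
variant, `0` as printed in E13.1). MODELLED: zero-power fault, MV-1. -/
def K13fault (Df : ℝ) : SMIB where
  M := 7 / 377
  D := Df
  Pm := 79912287 / 88791425
  PC := 0
  PM := 0
  γ := 0

/-- Along a fault-on solution `Y = (δ, ω)` of `K13fault Df` on `[0, T]` the two scalar
within-derivative relations of lit-1's equal-area theorems hold: `δ' = ω`,
`ω' = (P_m′ − Df ω)/M`. -/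
theorem K13fault_scalar {Df T : ℝ} {Y : ℝ → ℝ × ℝ} (hY : (K13fault Df).IsSolutionOn Y (Icc 0 T)) :
    (∀ t ∈ Icc 0 T, HasDerivWithinAt (fun s => (Y s).1) ((fun s => (Y s).2) t) (Icc 0 T) t) ∧
      ∀ t ∈ Icc 0 T, HasDerivWithinAt (fun s => (Y s).2)
        (((79912287 / 88791425 : ℝ) - Df * (fun s => (Y s).2) t) / (7 / 377 : ℝ)) (Icc 0 T) t := by
  constructor
  · intro t ht
    have h := ((hY t ht).hasFDerivWithinAt.fst).hasDerivWithinAt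
    simpa [field] using h
  · intro t ht
    have h := ((hY t ht).hasFDerivWithinAt.snd).hasDerivWithinAt
    simpa [field, Pe, K13fault] using h

/-- Certified cosine lower bound at the equal-area angle used below: `0.6126 ≤ cos 0.9113`
(`cos 0.9113 = 0.61275…`; `1 − x²/2 ≤ cos x` at `0.9113/16` and four doublings). -/
theorem cos_09113_ge : (6126 / 10000 : ℝ) ≤ cos (9113 / 10000 : ℝ) := by
  have hq : (9113 / 10000 : ℝ) = 2 * (2 * (2 * (2 * (9113 / 160000 : ℝ)))) := by norm_num
  have h0 : (1 : ℝ) - (9113 / 160000 : ℝ) ^ 2 / 2 ≤ cos (9113 / 160000 : ℝ) :=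
    one_sub_sq_div_two_le_cos
  have h1 := cos_two_mul_ge (by norm_num) h0
  have h2 := cos_two_mul_ge (by norm_num) h1
  have h3 := cos_two_mul_ge (by norm_num) h2
  have h4 := cos_two_mul_ge (by norm_num) h3
  rw [← hq] at h4
  exact le_trans (by norm_num) h4

/-- **Equal-area criterion as a kernel number for «SMIB-K13post-D10».** MODELLED: classical SMIB
`M_smib` (MV-1), post-fault record `K13postD10` (`M = 7/377`, `D = 10/377`, `P_m′ = 79912287/88791425`,
`P_M = 689/625`, A1″/MV-P), zero-power fault-on record `K13fault Df` with any `Df ≥ 0`, pre-fault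
angle `δ₀ ∈ [0.7290, 0.7291]` rad (printed `41.77°` [cite: Kundur1994, Example 13.1]) and `ω₀ = 0`.
STATEMENT: for every fault-on motion `Y` on `[0, T]` with `0 ≤ T ≤ 0.0866` and every such `δ₀`, the
clearing state `Y T` (i) admits a post-fault solution on every `[0, S]`, and (ii) EVERY post-fault
solution `X` of `K13postD10` from `Y T` satisfies, for all `t ≥ 0`, `δ(t) ∈ (−π − δˢ, π − δˢ)` (no pole
slip) and `V(X t) ≤ V(Y T)`, and `X → (δˢ, 0)`. Hence `0.0866 s ≤` the model's critical clearing time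
for this fault class (energy route; VALIDATED comparators in the module docstring). Proof =
lit-1 `equalArea_zeroPowerFault_resync` at `δ₁ = 0.9113` through `SMIB.toLit`.
[cite: Kundur1994, Example 13.1 (b); SauerPai1998, §9.6.3 (9.48)] -/
theorem K13postD10_equalArea_resync {Df T : ℝ} (hDf : 0 ≤ Df) (hT0 : 0 ≤ T)
    (hT : T ≤ 433 / 5000) {Y : ℝ → ℝ × ℝ} (hY : (K13fault Df).IsSolutionOn Y (Icc 0 T))
    (hδ0 : (Y 0).1 ∈ Icc (7290 / 10000 : ℝ) (7291 / 10000)) (hω0 : (Y 0).2 = 0) :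
    (∃ X : ℝ → ℝ × ℝ, X 0 = Y T ∧ ∀ S : ℝ, K13postD10.IsSolutionOn X (Icc 0 S)) ∧
    ∀ X : ℝ → ℝ × ℝ, X 0 = Y T → (∀ S : ℝ, K13postD10.IsSolutionOn X (Icc 0 S)) →
      (∀ t, 0 ≤ t → (X t).1 ∈ Ioo (-π - deltaK13) (π - deltaK13) ∧
        K13postD10.energy deltaK13 (X t) ≤ K13postD10.energy deltaK13 (Y T)) ∧
      Tendsto X atTop (𝓝 (deltaK13, 0)) := by
  obtain ⟨hδ, hω⟩ := K13fault_scalar hY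
  set p := K13postD10.toLit with hp
  have hpv : p = ⟨7 / 377, 10 / 377, 79912287 / 88791425, 689 / 625⟩ := K13postD10_toLit
  have hM : 0 < p.M := by rw [hpv]; norm_num
  have hD : 0 < p.D := by rw [hpv]; norm_num
  have hPmax : 0 < p.Pmax := by rw [hpv]; norm_num
  have heq : p.IsEquilibriumAngle deltaK13 :=
    (toLit_isEquilibriumAngle_iff K13postD10_γ deltaK13).2 K13postD10_isEquilibrium
  have hω' : ∀ t ∈ Icc 0 T, HasDerivWithinAt (fun s => (Y s).2)
      ((p.Pm - Df * (fun s => (Y s).2) t) / p.M) (Icc 0 T) t := by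
    intro t ht
    have h := hω t ht
    rw [hpv]
    simpa using h
  -- the equal-area inequality at δ₁ = 0.9113 and the clearing-time inequality
  have hπ := Real.pi_lt_d6
  have hδs := deltaK13_gt
  have hcos := cos_09113_ge
  have hEA : p.Pm * (π - deltaK13 - (fun s => (Y s).1) 0) - p.Pmax * Real.cos deltaK13 ≤
      p.Pmax * Real.cos (9113 / 10000 : ℝ) := by
    rw [hpv, cos_deltaK13]
    simp only [cStar]
    push_cast
    have h0 := hδ0.1
    norm_num at hπ hδs hcos h0 ⊢
    nlinarith
  have hTime : (fun s => (Y s).1) 0 + p.Pm * T ^ 2 / (2 * p.M) < (9113 / 10000 : ℝ) := by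
    rw [hpv]
    have h1 := hδ0.2
    have hT2 : T ^ 2 ≤ (433 / 5000 : ℝ) ^ 2 := pow_le_pow_left₀ hT0 hT 2
    norm_num at h1 hT2 ⊢
    nlinarith
  have hδ00 : 0 ≤ (fun s => (Y s).1) 0 := by have := hδ0.1; norm_num at this ⊢; linarith
  have hδ0s : (fun s => (Y s).1) 0 + deltaK13 ≤ π := by
    have := hδ0.2; have h2 := deltaK13_lt_pi_div_two; norm_num at this ⊢
    linarith [Real.pi_gt_three]
  have hδ₁π : (9113 / 10000 : ℝ) ≤ π := by linarith [Real.pi_gt_three]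
  have key := p.equalArea_zeroPowerFault_resync hM hD hPmax heq deltaK13_pos.le
    deltaK13_lt_pi_div_two hDf hT0 hδ hω' hω0 hδ00 hδ0s hδ₁π hEA hTime
  -- back to model-1's vocabulary
  have hYT : ((fun s => (Y s).1) T, (fun s => (Y s).2) T) = Y T := rfl
  rw [hYT] at key
  obtain ⟨⟨X, hX0, hX⟩, hall⟩ := key
  refine ⟨⟨X, hX0, fun S => (isSolutionOn_iff_toLit K13postD10_γ X _).2 (hX S)⟩,
    fun X hX0 hX => ?_⟩
  obtain ⟨hstay, hlim⟩ :=
    hall X hX0 fun S => (isSolutionOn_iff_toLit K13postD10_γ X _).1 (hX S)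
  refine ⟨fun t ht => ⟨(hstay t ht).1, ?_⟩, hlim⟩
  have h := (hstay t ht).2
  simpa only [hp, toLit_energy K13postD10_γ] using h

end Summit.Ventures.GridStability.Models.SMIB

end
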